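import Summits.BirchSwinnertonDyer.BirchSwinnertonDyer.Theorems.ThetaPartnerAtTwoSignedControlAtTwoPlusTowerLadderTwo
import HarnessLib

/-!
# The PLUS tower at `2`, IV: the relative step `ℚ₂(v_{M+1}) ⊃ ℚ₂(v_M)` — integral decomposition `𝒪' = 𝒪 ⊕ 𝒪·v_{M+1}`,
# the FROBENIUS property `y² ∈ 𝒪 + 2𝒪'`, and the twisted generation `𝒪' = ℤ⟨σ^i v_{M+1}⟩ + 𝒪 + 2^a 𝒪'` (TGEN)
# (K4 `SignedControlAtTwo`, stmt-BirchSwinnertonDyer-20309, line `eulerchar` v6, stub HONDA⁺@2 — memo LAGPLUS-AT-2-CONSTRUCTION §4 (iii), (v))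

Route `ThetaPartnerAtTwo` (TP2; crux shared with `ResidualThetaTransportAtTwo`), crux K4, lead seat `prover-bsd-wall-tp2-p3` (g2).
Sequel of `…PlusTowerTwo` (I), `…PlusTowerIntegersTwo` (II), `…PlusTowerLadderTwo` (III: the tower lemma `(T)`), namespace
`SignedEC.PlusTower`. Notation: `v = v_M`, `v' = v_{M+1}` (`v'² + 4v' = v`), `k = ℚ₂(v) ⊂ k' = ℚ₂(v')`, `𝒪 = 𝒪_k`, `𝒪' = 𝒪_{k'}`
(elements of `ℚ̄₂` in the field with norm `≤ 1`), `σ = σ₃` (`σ ζ_{2^{M+1}} = ζ_{2^{M+1}}³`), `M ≥ 2`.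

WHAT (pure algebra of the plus tower; these are the two TOWER INPUTS of Kobayashi's generation step Prop. 8.11 ⇒ 8.12, in the
form the K3 lead's all-primes port `…SignedKatoUpToAtTwoLocalTowerGeneration.exists_sub_closure_sub_smul_mem'` consumes them for the
full cyclotomic layers — `frob_layerField'` and `exists_sub_pow_mul_mem_closure_sup` — now for the PLUS layers at `p = 2`):
* §1 `adjoin_v_le_adjoin_v_succ` (`k ≤ k'`), `exists_pow_v_succ_eq_add_mul` / **`exists_eq_add_mul_v_succ`** (B4a):
  every `x ∈ 𝒪'` is `a + b·v'` with `a, b ∈ 𝒪` (from `𝒪' = ℤ₂[v']`, file II, and `v'² = v − 4v'`);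
* §2 **`exists_norm_sq_sub_le`** (B4b, FROB⁺): every `y ∈ 𝒪'` has `‖y² − s‖ ≤ ‖2‖` for some `s ∈ 𝒪`
  (`(a + bv')² = (a² + b²v) + 2(ab − 2b²)v'`) — the hypothesis `hFrob` of `…LocalHonda.exists_mem_norm_ptLog_sub_le_one'`, whence
  «Prop 8.11⁺ at 2»: `Λ(Ê(𝔪_{k'})) ⊆ k + 𝒪' = 𝒪·v' + k`;
* §3 `exists_pow_sigma_v_succ_eq` (`σ^i(v') = c_i·v' + w_i`, `c_i = φ^i(1)`, `w_i ∈ 𝒪`, `φ(y) = σ(y)(1 + v)`) and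
  **`exists_mem_closure_pow_sigma_add`** (B4c, TGEN): every `x ∈ 𝒪'` is `s + y + 2^a·x'` with `s ∈ ⟨σ^i(v') : i⟩_ℤ`, `y ∈ 𝒪`,
  `x' ∈ 𝒪'` — from (B4a) and the tower lemma `(T)` (file III) for the coefficient `b`.
HONEST FRAMING: THEOREMS ONLY (no definition, no named fact, no `sorry`), route-independent; closes no item; BSD is not proved by any of this.

References: [Kobayashi2003] Props. 8.11–8.12 (pp. 17–18); [SerreLocalFields1979] Ch. I §6, Ch. IV §4; [Washington1997] §13.1.
-/

set_option autoImplicit false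
-- the Theorems namespace of this sub repeats the summit name by design (D-0017 nested layout)
set_option linter.dupNamespace false

noncomputable section

open scoped Classical IntermediateField
open Polynomial

namespace Summit.BirchSwinnertonDyer.BirchSwinnertonDyer.Theorems.SignedEC.PlusTower

open Summit.BirchSwinnertonDyer.Rank1Residual.Additive.PadicCyclotomicTower

/-! ## §1 `k ≤ k'` and the integral decomposition `𝒪' = 𝒪 + 𝒪·v'` -/

/-- `ℚ₂(v_M) ≤ ℚ₂(v_{M+1})` (`v_M = v_{M+1}² + 4v_{M+1}`). [cite: Washington1997, §13.1] -/
theorem adjoin_v_le_adjoin_v_succ (M : ℕ) :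
    ℚ_[2]⟮zeta 2 M + (zeta 2 M)⁻¹ - 2⟯ ≤ ℚ_[2]⟮zeta 2 (M + 1) + (zeta 2 (M + 1))⁻¹ - 2⟯ := by
  rw [IntermediateField.adjoin_simple_le_iff, ← v_succ_sq_add M]
  have h := IntermediateField.mem_adjoin_simple_self ℚ_[2] (zeta 2 (M + 1) + (zeta 2 (M + 1))⁻¹ - 2)
  exact add_mem (pow_mem h 2) (mul_mem (by exact_mod_cast IntermediateField.natCast_mem _ 4) h)

/-- A finite sum of elements of `k` of norm `≤ 1` is an element of `k` of norm `≤ 1`. [folklore] -/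
theorem sum_mem_and_norm_le_one {K : IntermediateField ℚ_[2] (PadicAlgCl 2)} {ι : Type*} (s : Finset ι)
    (f : ι → PadicAlgCl 2) (h : ∀ i ∈ s, f i ∈ K ∧ ‖f i‖ ≤ 1) :
    (∑ i ∈ s, f i) ∈ K ∧ ‖∑ i ∈ s, f i‖ ≤ 1 :=
  ⟨sum_mem fun i hi ↦ (h i hi).1,
    IsUltrametricDist.norm_sum_le_of_forall_le_of_nonneg zero_le_one fun i hi ↦ (h i hi).2⟩

/-- `c • y ∈ 𝒪_k` for `c ∈ ℤ₂ ⊂ ℚ₂` (`‖c‖ ≤ 1`) and `y ∈ 𝒪_k`. [folklore] -/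
theorem smul_mem_and_norm_le_one {K : IntermediateField ℚ_[2] (PadicAlgCl 2)} {c : ℚ_[2]} (hc : ‖c‖ ≤ 1)
    {y : PadicAlgCl 2} (hy : y ∈ K ∧ ‖y‖ ≤ 1) : c • y ∈ K ∧ ‖c • y‖ ≤ 1 := by
  refine ⟨IntermediateField.smul_mem K hy.1, ?_⟩
  rw [Algebra.smul_def, norm_mul, PadicAlgCl.norm_extends]
  exact mul_le_one₀ hc (norm_nonneg _) hy.2

/-- **Powers of `v'` decompose**: `v'^j = A + B·v'` with `A, B ∈ 𝒪_k` (induction with `v'² = v − 4v'`). [folklore] -/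
theorem exists_pow_v_succ_eq_add_mul {M : ℕ} (hM : 2 ≤ M) (j : ℕ) :
    ∃ A, (A ∈ ℚ_[2]⟮zeta 2 M + (zeta 2 M)⁻¹ - 2⟯ ∧ ‖A‖ ≤ 1) ∧
      ∃ B, (B ∈ ℚ_[2]⟮zeta 2 M + (zeta 2 M)⁻¹ - 2⟯ ∧ ‖B‖ ≤ 1) ∧
        (zeta 2 (M + 1) + (zeta 2 (M + 1))⁻¹ - 2) ^ j = A + B * (zeta 2 (M + 1) + (zeta 2 (M + 1))⁻¹ - 2) := by
  set v := zeta 2 M + (zeta 2 M)⁻¹ - 2 with hv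
  set v' := zeta 2 (M + 1) + (zeta 2 (M + 1))⁻¹ - 2 with hv'
  set K := ℚ_[2]⟮v⟯ with hK
  have hvK : v ∈ K := IntermediateField.mem_adjoin_simple_self ℚ_[2] v
  have hv1 : ‖v‖ ≤ 1 := norm_v_le_one hM
  have hsq : v' ^ 2 = v - 4 * v' := v_succ_sq M
  induction j with
  | zero => exact ⟨1, ⟨one_mem K, norm_one.le⟩, 0, ⟨zero_mem K, by simp⟩, by rw [pow_zero, zero_mul, add_zero]⟩
  | succ j ih =>
    obtain ⟨A, ⟨hAK, hA1⟩, B, ⟨hBK, hB1⟩, hj⟩ := ih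
    refine ⟨B * v, ⟨mul_mem hBK hvK, ?_⟩, A - 4 * B, ⟨sub_mem hAK (mul_mem ?_ hBK), ?_⟩, ?_⟩
    · rw [norm_mul]; exact mul_le_one₀ hB1 (norm_nonneg _) hv1
    · exact_mod_cast IntermediateField.natCast_mem K 4
    · rw [sub_eq_add_neg]
      refine (IsUltrametricDist.norm_add_le_max _ _).trans (max_le hA1 ?_)
      rw [norm_neg, norm_mul]
      refine mul_le_one₀ ?_ (norm_nonneg _) hB1
      have h2 : ‖(2 : PadicAlgCl 2)‖ ≤ 1 := by
        have := (Literature.NumberTheory.GaloisRepresentations.PadicAlgCl.norm_natCast_prime_pos_lt_one (p := 2)).2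
        exact_mod_cast this.le
      rw [show (4 : PadicAlgCl 2) = 2 * 2 by norm_num, norm_mul]
      exact mul_le_one₀ h2 (norm_nonneg _) h2
    · rw [pow_succ, hj]
      linear_combination B * hsq

/-- **Integral decomposition `𝒪_{k'} = 𝒪_k + 𝒪_k·v'`** (B4a; `M ≥ 2`): every `x ∈ ℚ₂(v_{M+1})` with `‖x‖ ≤ 1` is `a + b·v_{M+1}` with
`a, b ∈ ℚ₂(v_M)`, `‖a‖, ‖b‖ ≤ 1` (`𝒪_{k'} = ℤ₂[v']`, file II, and the decomposition of the powers of `v'`). (`v'` is a uniformizer of the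
totally ramified quadratic extension `k'/k`.) [cite: SerreLocalFields1979, Ch. I §6 Prop. 18] -/
theorem exists_eq_add_mul_v_succ {M : ℕ} (hM : 2 ≤ M) {x : PadicAlgCl 2}
    (hx : x ∈ ℚ_[2]⟮zeta 2 (M + 1) + (zeta 2 (M + 1))⁻¹ - 2⟯) (hx1 : ‖x‖ ≤ 1) :
    ∃ a, (a ∈ ℚ_[2]⟮zeta 2 M + (zeta 2 M)⁻¹ - 2⟯ ∧ ‖a‖ ≤ 1) ∧
      ∃ b, (b ∈ ℚ_[2]⟮zeta 2 M + (zeta 2 M)⁻¹ - 2⟯ ∧ ‖b‖ ≤ 1) ∧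
        x = a + b * (zeta 2 (M + 1) + (zeta 2 (M + 1))⁻¹ - 2) := by
  set v' := zeta 2 (M + 1) + (zeta 2 (M + 1))⁻¹ - 2 with hv'
  obtain ⟨r, -, hrc, hrx⟩ := exists_intPoly_aeval_v_eq (by omega : 2 ≤ M + 1) hx hx1
  choose A hA B hB hAB using fun j ↦ exists_pow_v_succ_eq_add_mul hM j
  refine ⟨∑ j ∈ Finset.range (r.natDegree + 1), r.coeff j • A j,
    sum_mem_and_norm_le_one _ _ fun j _ ↦ smul_mem_and_norm_le_one (hrc j) (hA j),
    ∑ j ∈ Finset.range (r.natDegree + 1), r.coeff j • B j,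
    sum_mem_and_norm_le_one _ _ fun j _ ↦ smul_mem_and_norm_le_one (hrc j) (hB j), ?_⟩
  rw [← hrx, aeval_eq_sum_range, Finset.sum_mul, ← Finset.sum_add_distrib]
  refine Finset.sum_congr rfl fun j _ ↦ ?_
  rw [← hv', hAB j, smul_add, smul_mul_assoc]

/-! ## §2 The Frobenius property of the plus tower (FROB⁺) -/

/-- **FROB⁺ (B4b): `y² ∈ 𝒪_k + 2𝒪_{k'}` for `y ∈ 𝒪_{k'}`** (`M ≥ 2`): there is `s ∈ ℚ₂(v_M)`, `‖s‖ ≤ 1`, with `‖y² − s‖ ≤ ‖2‖`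
(`y = a + bv'`, `y² = (a² + b²v) + 2(ab − 2b²)v'`). This is the hypothesis `hFrob` of the K3 lead's generic Prop. 8.11
`…LocalHonda.exists_mem_norm_ptLog_sub_le_one'` for the pair `k ⊂ k'`, i.e. «Prop 8.11⁺ at 2»: `Λ(Ê(𝔪_{k'})) ⊆ k + 𝒪_{k'}`.
[cite: Kobayashi2003, Prop. 8.11] -/
theorem exists_norm_sq_sub_le {M : ℕ} (hM : 2 ≤ M) {y : PadicAlgCl 2}
    (hy : y ∈ ℚ_[2]⟮zeta 2 (M + 1) + (zeta 2 (M + 1))⁻¹ - 2⟯) (hy1 : ‖y‖ ≤ 1) :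
    ∃ s ∈ ℚ_[2]⟮zeta 2 M + (zeta 2 M)⁻¹ - 2⟯, ‖s‖ ≤ 1 ∧ ‖y ^ 2 - s‖ ≤ ‖(2 : PadicAlgCl 2)‖ := by
  set v := zeta 2 M + (zeta 2 M)⁻¹ - 2 with hv
  set v' := zeta 2 (M + 1) + (zeta 2 (M + 1))⁻¹ - 2 with hv'
  set K := ℚ_[2]⟮v⟯ with hK
  have hvK : v ∈ K := IntermediateField.mem_adjoin_simple_self ℚ_[2] v
  have hv1 : ‖v‖ ≤ 1 := norm_v_le_one hM
  have hv'1 : ‖v'‖ ≤ 1 := norm_v_le_one (by omega : 2 ≤ M + 1)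
  have hsq : v' ^ 2 = v - 4 * v' := v_succ_sq M
  obtain ⟨a, ⟨haK, ha1⟩, b, ⟨hbK, hb1⟩, rfl⟩ := exists_eq_add_mul_v_succ hM hy hy1
  refine ⟨a ^ 2 + b ^ 2 * v, add_mem (pow_mem haK 2) (mul_mem (pow_mem hbK 2) hvK), ?_, ?_⟩
  · refine (IsUltrametricDist.norm_add_le_max _ _).trans (max_le ?_ ?_)
    · rw [norm_pow]; exact pow_le_one₀ (norm_nonneg _) ha1
    · rw [norm_mul, norm_pow]; exact mul_le_one₀ (pow_le_one₀ (norm_nonneg _) hb1) (norm_nonneg _) hv1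
  · have e : (a + b * v') ^ 2 - (a ^ 2 + b ^ 2 * v) = 2 * ((a * b - 2 * b ^ 2) * v') := by
      linear_combination b ^ 2 * hsq
    rw [e, norm_mul]
    refine mul_le_of_le_one_right (norm_nonneg _) ?_
    rw [norm_mul]
    refine mul_le_one₀ ?_ (norm_nonneg _) hv'1
    rw [sub_eq_add_neg]
    refine (IsUltrametricDist.norm_add_le_max _ _).trans (max_le ?_ ?_)
    · rw [norm_mul]; exact mul_le_one₀ ha1 (norm_nonneg _) hb1
    · rw [norm_neg, norm_mul, norm_pow]
      have h2 : ‖(2 : PadicAlgCl 2)‖ ≤ 1 := by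
        have := (Literature.NumberTheory.GaloisRepresentations.PadicAlgCl.norm_natCast_prime_pos_lt_one (p := 2)).2
        exact_mod_cast this.le
      exact mul_le_one₀ h2 (pow_nonneg (norm_nonneg _) _) (pow_le_one₀ (norm_nonneg _) hb1)

/-! ## §3 Twisted generation of `𝒪'` over `𝒪` (TGEN) -/

/-- **`σ^i(v') = c_i·v' + w_i`** with `c_i = φ^i(1)` (`φ(y) = σ(y)(1 + v)`, the twisted orbit of the tower lemma) and `c_i, w_i ∈ 𝒪_k`
(`M ≥ 2`, `σ ζ_{2^{M+1}} = ζ_{2^{M+1}}³`; induction on `i` with `σ(v') = (1 + v)v' + 2v`). [cite: Washington1997, §13.1] -/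
theorem exists_pow_sigma_v_succ_eq {M : ℕ} (hM : 2 ≤ M) {σ : PadicAlgCl 2 ≃ₐ[ℚ_[2]] PadicAlgCl 2}
    (hσ : σ (zeta 2 (M + 1)) = zeta 2 (M + 1) ^ 3) (i : ℕ) :
    ((fun y : PadicAlgCl 2 ↦ σ y * (1 + (zeta 2 M + (zeta 2 M)⁻¹ - 2)))^[i] 1 ∈ ℚ_[2]⟮zeta 2 M + (zeta 2 M)⁻¹ - 2⟯ ∧
      ‖(fun y : PadicAlgCl 2 ↦ σ y * (1 + (zeta 2 M + (zeta 2 M)⁻¹ - 2)))^[i] 1‖ ≤ 1) ∧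
    ∃ w, (w ∈ ℚ_[2]⟮zeta 2 M + (zeta 2 M)⁻¹ - 2⟯ ∧ ‖w‖ ≤ 1) ∧
      (σ ^ i) (zeta 2 (M + 1) + (zeta 2 (M + 1))⁻¹ - 2) =
        (fun y : PadicAlgCl 2 ↦ σ y * (1 + (zeta 2 M + (zeta 2 M)⁻¹ - 2)))^[i] 1 *
          (zeta 2 (M + 1) + (zeta 2 (M + 1))⁻¹ - 2) + w := by
  set v := zeta 2 M + (zeta 2 M)⁻¹ - 2 with hv
  set v' := zeta 2 (M + 1) + (zeta 2 (M + 1))⁻¹ - 2 with hv'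
  set K := ℚ_[2]⟮v⟯ with hK
  set F : PadicAlgCl 2 → PadicAlgCl 2 := fun y ↦ σ y * (1 + v) with hF
  have hvK : v ∈ K := IntermediateField.mem_adjoin_simple_self ℚ_[2] v
  have hv1 : ‖v‖ ≤ 1 := norm_v_le_one hM
  have h1v : ‖1 + v‖ ≤ 1 := (IsUltrametricDist.norm_add_le_max 1 v).trans (max_le norm_one.le hv1)
  have hσM : σ (zeta 2 M) = zeta 2 M ^ 3 := apply_zeta_of_apply_zeta_succ hσ
  have hσv' : σ v' = (1 + v) * v' + 2 * v := sigma_three_v_succ hσ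
  have h2 : ‖(2 : PadicAlgCl 2)‖ ≤ 1 := by
    have := (Literature.NumberTheory.GaloisRepresentations.PadicAlgCl.norm_natCast_prime_pos_lt_one (p := 2)).2
    exact_mod_cast this.le
  have h2K : (2 : PadicAlgCl 2) ∈ K := by exact_mod_cast IntermediateField.natCast_mem K 2
  induction i with
  | zero =>
    refine ⟨⟨?_, ?_⟩, 0, ⟨zero_mem K, by simp⟩, ?_⟩
    · rw [Function.iterate_zero_apply]; exact one_mem K
    · rw [Function.iterate_zero_apply, norm_one]
    · rw [pow_zero, AlgEquiv.one_apply, Function.iterate_zero_apply, one_mul, add_zero]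
  | succ i ih =>
    obtain ⟨⟨hcK, hc1⟩, w, ⟨hwK, hw1⟩, hi⟩ := ih
    set c := F^[i] 1 with hc
    have hσcK : σ c ∈ K := sigma_mem_adjoin_v hM hσM hcK
    have hσwK : σ w ∈ K := sigma_mem_adjoin_v hM hσM hwK
    refine ⟨⟨?_, ?_⟩, 2 * (σ c * v) + σ w, ⟨add_mem (mul_mem h2K (mul_mem hσcK hvK)) hσwK, ?_⟩, ?_⟩
    · rw [Function.iterate_succ_apply', ← hc]
      exact mul_mem hσcK (add_mem (one_mem K) hvK)
    · rw [Function.iterate_succ_apply', ← hc, norm_mul, norm_algEquiv]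
      exact mul_le_one₀ hc1 (norm_nonneg _) h1v
    · refine (IsUltrametricDist.norm_add_le_max _ _).trans (max_le ?_ ?_)
      · rw [norm_mul, norm_mul, norm_algEquiv]
        exact mul_le_one₀ h2 (mul_nonneg (norm_nonneg _) (norm_nonneg _)) (mul_le_one₀ hc1 (norm_nonneg _) hv1)
      · rw [norm_algEquiv]; exact hw1
    · rw [pow_succ', AlgEquiv.mul_apply, hi, map_add, map_mul, hσv', Function.iterate_succ_apply', ← hc]
      ring

/-- **TGEN (B4c): `𝒪_{k'} = ℤ⟨σ^i(v') : i⟩ + 𝒪_k + 2^a·𝒪_{k'}`** (`M ≥ 2`, `σ ζ_{2^{M+1}} = ζ_{2^{M+1}}³`, every `a`): every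
`x ∈ ℚ₂(v_{M+1})` with `‖x‖ ≤ 1` is `s + y + 2^a·x'` with `s` an integral combination of the conjugates `σ^i(v_{M+1})`, `y ∈ ℚ₂(v_M)`,
`‖y‖ ≤ 1`, and `x' ∈ ℚ₂(v_{M+1})`, `‖x'‖ ≤ 1`. Proof: `x = a + b v'` (B4a), `b = ∑ nᵢcᵢ + 2^a b'` (tower lemma `(T)`, file III), and
`cᵢ v' = σ^i(v') − wᵢ`. The plus-tower analogue at `p = 2` of the cyclotomic «`𝔪_m = ℤ[Γ](ζ_m − 1) + 𝔪_{m−1} (+ p^a𝒪_m)`»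
(`PadicCyclotomicTower.exists_sub_pow_mul_mem_closure_sup`) consumed by Kobayashi's generation step. [cite: Kobayashi2003, Props. 8.11–8.12] -/
theorem exists_mem_closure_pow_sigma_add {M : ℕ} (hM : 2 ≤ M) {σ : PadicAlgCl 2 ≃ₐ[ℚ_[2]] PadicAlgCl 2}
    (hσ : σ (zeta 2 (M + 1)) = zeta 2 (M + 1) ^ 3) (a : ℕ) {x : PadicAlgCl 2}
    (hx : x ∈ ℚ_[2]⟮zeta 2 (M + 1) + (zeta 2 (M + 1))⁻¹ - 2⟯) (hx1 : ‖x‖ ≤ 1) :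
    ∃ s ∈ AddSubgroup.closure (Set.range fun i : ℕ ↦ (σ ^ i) (zeta 2 (M + 1) + (zeta 2 (M + 1))⁻¹ - 2)),
      ∃ y, (y ∈ ℚ_[2]⟮zeta 2 M + (zeta 2 M)⁻¹ - 2⟯ ∧ ‖y‖ ≤ 1) ∧
        ∃ x', (x' ∈ ℚ_[2]⟮zeta 2 (M + 1) + (zeta 2 (M + 1))⁻¹ - 2⟯ ∧ ‖x'‖ ≤ 1) ∧ x = s + y + 2 ^ a * x' := by
  set v := zeta 2 M + (zeta 2 M)⁻¹ - 2 with hv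
  set v' := zeta 2 (M + 1) + (zeta 2 (M + 1))⁻¹ - 2 with hv'
  set K := ℚ_[2]⟮v⟯ with hK
  set K' := ℚ_[2]⟮v'⟯ with hK'
  set F : PadicAlgCl 2 → PadicAlgCl 2 := fun y ↦ σ y * (1 + v) with hF
  set S : AddSubgroup (PadicAlgCl 2) := AddSubgroup.closure (Set.range fun i : ℕ ↦ (σ ^ i) v') with hS
  have hv'K' : v' ∈ K' := IntermediateField.mem_adjoin_simple_self ℚ_[2] v'
  have hv'1 : ‖v'‖ ≤ 1 := norm_v_le_one (by omega : 2 ≤ M + 1)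
  have hKK' : K ≤ K' := adjoin_v_le_adjoin_v_succ M
  have hσM : σ (zeta 2 M) = zeta 2 M ^ 3 := apply_zeta_of_apply_zeta_succ hσ
  -- `x = a₀ + b v'`, `b = t + 2^a b'` with `t ∈ ⟨c_i⟩`
  obtain ⟨a₀, ⟨ha₀K, ha₀1⟩, b, ⟨hbK, hb1⟩, rfl⟩ := exists_eq_add_mul_v_succ hM hx hx1
  obtain ⟨t, ht, b', hb'K, hb'1, hb⟩ := exists_mem_closure_iterate_add_two_pow_mul hM hσM a hbK hb1
  -- `t·v' ∈ S + 𝒪_k` for every `t ∈ ⟨c_i⟩`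
  have key : ∀ t ∈ AddSubgroup.closure (Set.range fun i : ℕ ↦ F^[i] 1),
      ∃ s ∈ S, ∃ w, (w ∈ K ∧ ‖w‖ ≤ 1) ∧ t * v' = s + w := by
    intro t ht
    induction ht using AddSubgroup.closure_induction with
    | mem c hc =>
      obtain ⟨i, rfl⟩ := hc
      obtain ⟨-, w, ⟨hwK, hw1⟩, hi⟩ := exists_pow_sigma_v_succ_eq hM hσ i
      refine ⟨(σ ^ i) v', AddSubgroup.subset_closure (Set.mem_range_self i), -w, ⟨neg_mem hwK, by rw [norm_neg]; exact hw1⟩, ?_⟩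
      rw [← hv, ← hF] at hi
      rw [hi]; ring
    | zero => exact ⟨0, S.zero_mem, 0, ⟨zero_mem K, by simp⟩, by rw [zero_mul, add_zero]⟩
    | add t₁ t₂ _ _ ih₁ ih₂ =>
      obtain ⟨s₁, hs₁, w₁, ⟨hw₁K, hw₁1⟩, h₁⟩ := ih₁
      obtain ⟨s₂, hs₂, w₂, ⟨hw₂K, hw₂1⟩, h₂⟩ := ih₂
      refine ⟨s₁ + s₂, S.add_mem hs₁ hs₂, w₁ + w₂, ⟨add_mem hw₁K hw₂K,
        (IsUltrametricDist.norm_add_le_max _ _).trans (max_le hw₁1 hw₂1)⟩, ?_⟩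
      rw [add_mul, h₁, h₂]; ring
    | neg t _ ih =>
      obtain ⟨s, hs, w, ⟨hwK, hw1⟩, h⟩ := ih
      refine ⟨-s, S.neg_mem hs, -w, ⟨neg_mem hwK, by rw [norm_neg]; exact hw1⟩, ?_⟩
      rw [neg_mul, h]; ring
  obtain ⟨s, hs, w, ⟨hwK, hw1⟩, htv⟩ := key t ht
  refine ⟨s, hs, w + a₀, ⟨add_mem hwK ha₀K, (IsUltrametricDist.norm_add_le_max _ _).trans (max_le hw1 ha₀1)⟩,
    b' * v', ⟨mul_mem (hKK' hb'K) hv'K', ?_⟩, ?_⟩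
  · rw [norm_mul]; exact mul_le_one₀ hb'1 (norm_nonneg _) hv'1
  · rw [hb, add_mul, htv]; ring

end Summit.BirchSwinnertonDyer.BirchSwinnertonDyer.Theorems.SignedEC.PlusTower

end
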